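import Mathlib
import HarnessLib

/-!
# Log-derivative transfer by Cauchy's estimate (RH-FREE, generic complex analysis)

Cell rh-jensen, LADDER-RH rung J-P(P3) «log band», BAND crux `XiDerivBandRealAllRates`
(stmt-RiemannHypothesis-19913), line «band-one-window», stub `stub_nearZone` — its small-`a` part; seat
rh-jensen-idea-2 g7 (technique nudge `cauchy-transfer-nearzone`). RH-FREE; bears_on J-P(P3).
WHAT THIS IS NOT: nothing here concerns `ζ`; these are two generic lemmas.

* `re_logDeriv_ge_of_norm_sub_le` — if `U`, `M` are holomorphic on a neighbourhood of the closed disc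
  `closedBall v₀ R`, `M` is zero-free there and `‖U − M‖ ≤ ε‖M‖` on the closed disc with `ε < 1`, then
  `Re (U′/U)(v₀) ≥ Re (M′/M)(v₀) − ε / (R (1 − ε))`: a SUP bound for the model error becomes a bound for
  the LOG-DERIVATIVE error, by Cauchy's estimate (`Complex.norm_deriv_le_of_forall_mem_sphere_norm_le`)
  applied to the holomorphic quotient `η = U/M − 1`. Use: with the arc transform `U = xiSqArcU n h`
  (holomorphic in the centre for fixed `h`, tree `differentiableOn_xiSqArcU`) and a frozen-saddle model
  `M̂` (rational in the centre), the window lemma S5 (`ε ≤ 1/4` on discs of radius `2/ℓ`) yields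
  `∂ₓ log ‖U(x+iT)‖ ≥ 0.38 ℓ − ℓ/6 > 0` without a second saddle analysis for `∂ₓU`.
* `norm_lt_norm_of_re_logDeriv_pos` — if `φ : ℝ → ℂ` is differentiable on `[a, b]`, zero-free, and
  `Re (φ′/φ) > 0` on `(a, b)`, then `‖φ a‖ < ‖φ b‖` (so `x ↦ ‖U(x+iT)‖` strictly increasing gives the
  near-zone dominance `‖U(−a+iT)‖ < ‖U(a+iT)‖` for every small `a > 0` at once).
-/

set_option linter.dupNamespace false

noncomputable section

open Complex Metric Set

namespace Summit.RiemannHypothesis.RiemannHypothesis.Theorems.JensenPolynomials.LogBand.LogDerivTransfer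

/-- **Log-derivative transfer (Cauchy's estimate).** `U, M` holomorphic on a disc `ball v₀ R'`, `M`
zero-free there, and `‖U z − M z‖ ≤ ε ‖M z‖` on the smaller closed disc `closedBall v₀ R`
(`0 < R < R'`, `0 ≤ ε < 1`). Then `Re (M′/M)(v₀) − ε/(R(1−ε)) ≤ Re (U′/U)(v₀)`. RH-FREE. -/
theorem re_logDeriv_ge_of_norm_sub_le {U M : ℂ → ℂ} {v₀ : ℂ} {R R' ε : ℝ}
    (hR : 0 < R) (hRR' : R < R') (hε0 : 0 ≤ ε) (hε1 : ε < 1)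
    (hU : DifferentiableOn ℂ U (ball v₀ R')) (hM : DifferentiableOn ℂ M (ball v₀ R'))
    (hM0 : ∀ z ∈ ball v₀ R', M z ≠ 0)
    (happrox : ∀ z ∈ closedBall v₀ R, ‖U z - M z‖ ≤ ε * ‖M z‖) :
    (deriv M v₀ / M v₀).re - ε / (R * (1 - ε)) ≤ (deriv U v₀ / U v₀).re := by
  have hR' : 0 < R' := hR.trans hRR'
  have hv₀ : v₀ ∈ closedBall v₀ R := mem_closedBall_self hR.le
  have hv₀' : v₀ ∈ ball v₀ R' := mem_ball_self hR'
  have hsub : closedBall v₀ R ⊆ ball v₀ R' := closedBall_subset_ball hRR'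
  have hMv : M v₀ ≠ 0 := hM0 v₀ hv₀'
  -- the quotient η = U/M - 1 (kept opaque)
  obtain ⟨η, hη⟩ : ∃ η : ℂ → ℂ, η = fun z => U z / M z - 1 := ⟨_, rfl⟩
  have hηz : ∀ z ∈ ball v₀ R', U z = M z * (1 + η z) := by
    intro z hz
    have hMz := hM0 z hz
    rw [hη]; field_simp; ring
  have hηq : ∀ z ∈ ball v₀ R', η z = (U z - M z) / M z := by
    intro z hz
    have hMz := hM0 z hz
    rw [hη]; field_simp
  have hηdiff : DifferentiableOn ℂ η (ball v₀ R') := by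
    intro z hz
    have hUz := (hU z hz).differentiableAt (isOpen_ball.mem_nhds hz)
    have hMz := (hM z hz).differentiableAt (isOpen_ball.mem_nhds hz)
    rw [hη]
    exact ((hUz.div hMz (hM0 z hz)).sub_const 1).differentiableWithinAt
  have hηdc : DiffContOnCl ℂ η (ball v₀ R) :=
    (hηdiff.mono (by rw [closure_ball v₀ hR.ne']; exact hsub)).diffContOnCl
  -- sup bound on the sphere
  have hηbound : ∀ z ∈ sphere v₀ R, ‖η z‖ ≤ ε := by
    intro z hz
    have hz' : z ∈ closedBall v₀ R := sphere_subset_closedBall hz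
    have hMz : M z ≠ 0 := hM0 z (hsub hz')
    rw [hηq z (hsub hz'), norm_div, div_le_iff₀ (norm_pos_iff.2 hMz)]
    exact happrox z hz'
  -- Cauchy's estimate
  have hCauchy : ‖deriv η v₀‖ ≤ ε / R :=
    Complex.norm_deriv_le_of_forall_mem_sphere_norm_le hR hηdc hηbound
  -- η v₀ is small, so 1 + η v₀ ≠ 0
  have hηv : ‖η v₀‖ ≤ ε := by
    rw [hηq v₀ hv₀', norm_div, div_le_iff₀ (norm_pos_iff.2 hMv)]
    exact happrox v₀ hv₀
  have h1η : 1 - ε ≤ ‖1 + η v₀‖ := by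
    have := norm_sub_norm_le (1 : ℂ) (-(η v₀))
    simp only [norm_one, norm_neg, sub_neg_eq_add] at this
    linarith
  have h1ηpos : 0 < ‖1 + η v₀‖ := by linarith
  have h1ηne : 1 + η v₀ ≠ 0 := norm_pos_iff.1 h1ηpos
  have hUv : U v₀ = M v₀ * (1 + η v₀) := hηz v₀ hv₀'
  -- derivatives at v₀
  have hMd : HasDerivAt M (deriv M v₀) v₀ :=
    ((hM v₀ hv₀').differentiableAt (isOpen_ball.mem_nhds hv₀')).hasDerivAt
  have hηd : HasDerivAt η (deriv η v₀) v₀ :=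
    ((hηdiff v₀ hv₀').differentiableAt (isOpen_ball.mem_nhds hv₀')).hasDerivAt
  -- U = M * (1 + η) near v₀, hence U' = M' (1+η) + M η'
  have hUeq : U =ᶠ[nhds v₀] fun z => M z * (1 + η z) := by
    filter_upwards [isOpen_ball.mem_nhds hv₀'] with z hz
    exact hηz z hz
  have hprod : HasDerivAt (fun z => M z * (1 + η z))
      (deriv M v₀ * (1 + η v₀) + M v₀ * deriv η v₀) v₀ :=
    hMd.mul (hηd.const_add 1)
  have hderivU : deriv U v₀ = deriv M v₀ * (1 + η v₀) + M v₀ * deriv η v₀ :=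
    hUeq.deriv_eq.trans hprod.deriv
  -- log-derivative identity
  have hlog : deriv U v₀ / U v₀ = deriv M v₀ / M v₀ + deriv η v₀ / (1 + η v₀) := by
    rw [hderivU, hUv, div_add_div _ _ hMv h1ηne]
  rw [hlog, Complex.add_re]
  have h1ε : 0 < 1 - ε := by linarith
  have hbound : ‖deriv η v₀ / (1 + η v₀)‖ ≤ ε / (R * (1 - ε)) := by
    rw [norm_div, div_le_iff₀ h1ηpos]
    calc ‖deriv η v₀‖ ≤ ε / R := hCauchy
      _ = ε / (R * (1 - ε)) * (1 - ε) := by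
          rw [div_mul_eq_mul_div, mul_div_mul_right _ _ (ne_of_gt h1ε)]
      _ ≤ ε / (R * (1 - ε)) * ‖1 + η v₀‖ := by
          apply mul_le_mul_of_nonneg_left h1η
          positivity
  have hre : -(ε / (R * (1 - ε))) ≤ (deriv η v₀ / (1 + η v₀)).re :=
    neg_le_of_abs_le ((abs_re_le_norm _).trans hbound)
  linarith

/-- **Strict growth of the modulus from a positive log-derivative.** If `φ : ℝ → ℂ` has derivative
`φ' x` at every point of `[a, b]`, is zero-free there, and `Re (φ' x / φ x) > 0` on `(a, b)`, then
`‖φ a‖ < ‖φ b‖` (for `a < b`). RH-FREE. -/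
theorem norm_lt_norm_of_re_logDeriv_pos {φ φ' : ℝ → ℂ} {a b : ℝ} (hab : a < b)
    (hφ : ∀ x ∈ Icc a b, HasDerivAt φ (φ' x) x) (hφ0 : ∀ x ∈ Icc a b, φ x ≠ 0)
    (hpos : ∀ x ∈ Ioo a b, 0 < (φ' x / φ x).re) : ‖φ a‖ < ‖φ b‖ := by
  -- work with the square of the norm
  have hsq : ∀ x ∈ Icc a b, HasDerivAt (fun y => ‖φ y‖ ^ 2) (2 * (‖φ x‖ ^ 2 * (φ' x / φ x).re)) x := by
    intro x hx
    have h := (hφ x hx).norm_sq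
    have hinner : (inner ℝ (φ x) (φ' x) : ℝ) = ‖φ x‖ ^ 2 * (φ' x / φ x).re := by
      have hx0 := hφ0 x hx
      have hq : φ' x = (φ' x / φ x) * φ x := by field_simp
      calc (inner ℝ (φ x) (φ' x) : ℝ) = (φ' x * (starRingEnd ℂ) (φ x)).re := Complex.inner _ _
        _ = (((Complex.normSq (φ x) : ℝ) : ℂ) * (φ' x / φ x)).re := by
            rw [Complex.normSq_eq_conj_mul_self]
            congr 1
            field_simp
        _ = Complex.normSq (φ x) * (φ' x / φ x).re := Complex.re_ofReal_mul _ _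
        _ = ‖φ x‖ ^ 2 * (φ' x / φ x).re := by rw [Complex.normSq_eq_norm_sq]
    simpa [hinner] using h
  have hcont : ContinuousOn (fun y => ‖φ y‖ ^ 2) (Icc a b) :=
    fun x hx => (hsq x hx).continuousAt.continuousWithinAt
  have hmono : StrictMonoOn (fun y => ‖φ y‖ ^ 2) (Icc a b) := by
    apply strictMonoOn_of_deriv_pos (convex_Icc a b) hcont
    intro x hx
    rw [interior_Icc] at hx
    have hx' : x ∈ Icc a b := Ioo_subset_Icc_self hx
    rw [(hsq x hx').deriv]
    have h1 : 0 < ‖φ x‖ ^ 2 := by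
      have := norm_pos_iff.2 (hφ0 x hx'); positivity
    have := hpos x hx
    positivity
  have hlt := hmono (left_mem_Icc.2 hab.le) (right_mem_Icc.2 hab.le) hab
  have ha : 0 ≤ ‖φ a‖ := norm_nonneg _
  have hb : 0 ≤ ‖φ b‖ := norm_nonneg _
  nlinarith [hlt, ha, hb, sq_nonneg (‖φ a‖ - ‖φ b‖)]

end Summit.RiemannHypothesis.RiemannHypothesis.Theorems.JensenPolynomials.LogBand.LogDerivTransfer

end
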